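import Summits.HodgeConjecture.HodgeConjecture.Theses.LimitExtension
import Literature.AlgebraicGeometry.HodgeTheory.ComplexConjugationHolds

/-!
# Route LimitExtension — `HodgeModels` (support item stmt-HodgeConjecture-3050), `LimitExtension` copy

The support item `HodgeModels` of route `LimitExtension` —
`∀ ⦃n⦄ ⦃X⦄, IsSmoothProjective n X → Nonempty (HodgeModel n X)` (every smooth projective complex
variety of dimension `n` has a Hodge model: Serre's analytification, de Rham's theorem, the Hodge
decomposition of the compact Kähler manifold `X^an`) — is, definitionally, the named fact
`Literature.AlgebraicGeometry.HodgeTheory.nonempty_hodgeModel n X` for all `n`, `X`, which is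
DISCHARGED in the Literature library by `nonempty_hodgeModel_holds`
(`HodgeTheory/ComplexConjugationHolds`, relying on nothing unproved).  This file records the
one-line proof against the `LimitExtension` copy of the decl (the sibling route `NodalSupport` has
the same one-liner in `NodalSupportHodgeModels`), so that this route's deciding theorem `closes`
can be fed `HodgeModels` by name.
-/

noncomputable section

-- every declaration of this problem lives in `Summit.HodgeConjecture.HodgeConjecture.…` (summit = sub-problem)
set_option linter.dupNamespace false

namespace Summit.HodgeConjecture.HodgeConjecture.Theorems

/-- **Item stmt-HodgeConjecture-3050 (`HodgeModels`), `LimitExtension` copy**: every smooth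
projective complex variety has a Hodge model — by the Literature discharge
`nonempty_hodgeModel_holds` (Serre GAGA §2: analytification; de Rham; Voisin (2002) §6.1.3
Prop. 6.11: Hodge decomposition of compact Kähler manifolds).  The type is literally the route decl
`Summit.HodgeConjecture.HodgeConjecture.Theses.LimitExtension.HodgeModels`.
[cite: SerreGAGA1956, §2 n°5 Prop. 2 and n°7 Prop. 6]
[cite: VoisinHodgeI2002, §3.3.2 and §6.1.3 Prop. 6.11] -/
theorem limitExtension_hodgeModels_proof :
    Summit.HodgeConjecture.HodgeConjecture.Theses.LimitExtension.HodgeModels := by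
  unfold Summit.HodgeConjecture.HodgeConjecture.Theses.LimitExtension.HodgeModels
  exact fun n X ↦ Literature.AlgebraicGeometry.HodgeTheory.nonempty_hodgeModel_holds

end Summit.HodgeConjecture.HodgeConjecture.Theorems

end
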